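import Mathlib
import HarnessLib
import HarnessLib.Audit
import Summits.RiemannHypothesis.Statement
import Summits.RiemannHypothesis.RiemannHypothesis.Theorems.DBNDefs
import Summits.RiemannHypothesis.RiemannHypothesis.Theorems.DBNZeroDynamics
import Literature.NumberTheory.LFunctions.DeBruijnNewman
import Summits.RiemannHypothesis.RiemannHypothesis.Theorems.DBNBoundaryReduction
import Summits.RiemannHypothesis.RiemannHypothesis.Theorems.DBNClassFloor
import Literature.Barriers.RiemannHypothesis.NewmanConjecture
import Literature.NumberTheory.LFunctions.XiMoments
import Summits.RiemannHypothesis.RiemannHypothesis.Theorems.DBNKernelMasses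
import Summits.RiemannHypothesis.RiemannHypothesis.Theorems.Splittings.LinearRayRange21
import Summits.RiemannHypothesis.RiemannHypothesis.Theorems.Splittings.LinearRayDipCertificate
import HarnessLib.Audit.Status.Attr

/-!
Route: DBN

DORMANT since 2026-08-29T21:04:35Z (census g0: costume (trib-confirmed census-trib-costume-B 2026-08-29; 21-frontier 19:16:23Z (b)); reversible --off) — unstaffed, not closed; items shared with open routes are served there. `ledger route dormant <id> --off` reactivates.

# Route DBN — de Bruijn–Newman heat flow: Λ ≤ 0 via zero dynamics

**Thesis X (words).** For every `t > 0`, de Bruijn's function `H_t(z) = ∫₀^∞ e^{tu²} Φ(u) cos(zu)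
du` has only real
zeros (i.e. `Λ ≤ 0`; with Rodgers–Tao `Λ ≥ 0` this is `Λ = 0`).

Lean: `∀ t : ℝ, 0 < t → Literature.NumberTheory.LFunctions.HasOnlyRealZeros
(Literature.NumberTheory.LFunctions.deBruijnH t)`
(item `DbnThesis`, target, rank 0).

**Assembly / deciding theorem.** `closes : DbnHighUniform → DbnLowAllT → Assembly →
Summit.RiemannHypothesis`
(D-0027 §2.1, sorry-free, axioms propext/Classical.choice/Quot.sound, pure logic): the two cruxes
give X by a case
split on `|Re z|` at `6·10^{12}`, and the item `Assembly` is X → `Summit.RiemannHypothesis`.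
`Assembly` is a PROVED
result of the Literature —
`Literature.NumberTheory.LFunctions.riemannHypothesis_of_hasOnlyRealZeros_deBruijnH_holds`
(`Literature/NumberTheory/LFunctions/DeBruijnNewmanConstProofs.lean`: de Bruijn 1950 Thm 13, Newman
1976 Thm 3
closedness at `t = 0` via Hurwitz, `H_0 = ξ(1/2 + iz/2)/8`, RH ↔ `H_0` real-rooted) — so a prover
closes it in one
line from a Theorems file (`fun h ↦ riemannHypothesis_of_hasOnlyRealZeros_deBruijnH_holds h`; cf.
`Theorems/DBNDbnThesis.lean: dbnThesis_iff_summit`). The ROUTE FILE deliberately imports only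
`Literature.NumberTheory.LFunctions.DeBruijnNewman` (definitions `deBruijnH`, `HasOnlyRealZeros`;
every named fact in
that module and in `RiemannXi` is discharged): importing `DeBruijnNewmanConstProofs` here would drag
`Equivalents.lean` (unproved named facts `JensenPolyaCriterion` — an RH-equivalent —,
`platt_trudgian`,
`deBruijnNewmanConst_le`) into the route's import cone although no item uses them (route-repair
2026-08-15).

Rationale: WHY THIS LINE. (brief=widen; imports: parabolic PDE / backward heat equation, ODE dynamics of zeros
as a Coulomb gas,
certified numerics.) `H_t` solves the backward heat equation `∂_t H = -∂_z² H`; its zeros obey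
`ż_j = 2 Σ_{k≠j} (z_j - z_k)^{-1}` [CsordasSmithVarga1994; RodgersTao2020 §3]: real zeros repel and
stay real, complex
pairs are attracted to the axis, and the non-real zero count is non-increasing in `t` [Bruijn1950
Thm 13]. For each
fixed `t > 0` only finitely many zeros are non-real [KiKimLee2009 Thm 1.3], and the barrier method
[Polymath2019 §§6–8; PlattTrudgian2021] converts "RH verified to height `T₀`" + "no zero crosses `Re
z = 2T₀`
during `0 ≤ t ≤ t₀`" into `Λ ≤ t₀` (currently `Λ ≤ 0.2` from `T₀ = 3.0·10^{12}`). In `H_0(z) = ξ(1/2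
+ iz/2)/8` a
zero `β + iγ` of ζ is `z = 2γ - i(2β - 1)`, so Platt–Trudgian gives real zeros of `H_0` for `|Re z|
≤ 6.0·10^{12}`.
The route splits X at the height `6·10^{12}`: LOW zeros (numerics + monotone count, essentially in
print) and
HIGH zeros uniformly in `t > 0` — the crux, which is where dynamics must beat the `t → 0⁺`
degeneration
(the barrier method needs `T₀ → ∞` as `t₀ → 0`). Rodgers–Tao's "RH is barely true" makes the
negative side natural
here, so `Λ > 0` is filed as its own item. X → RH is a PROVED Literature theorem
(`Literature.NumberTheory.LFunctions.riemannHypothesis_of_hasOnlyRealZeros_deBruijnH_holds`),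
carried by the item
`Assembly`, so the deciding theorem `closes : DbnHighUniform → DbnLowAllT → Assembly →
Summit.RiemannHypothesis` is
pure logic over the route's own items and the route file imports nothing beyond
`DeBruijnNewman.lean`.

RANKED CRUXES. #2 DbnHighUniform — `∀ t > 0, ∀ z, H_t z = 0 → 6·10^{12} ≤ |Re z| → Im z = 0`: HIGH
zeros real,
UNIFORMLY in `t > 0` (why it might fail: t-uniform height is RH-strength — print has only `x ≥
exp(C/t)`
[Polymath2019 Thm 1.5(i), p.31 obstruction remark], and the flow is Euler-product-blind [Dobner2020,
Literature.Barriers.RiemannHypothesis.DavenportHeilbronn]; sources: arXiv:1904.12438,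
arXiv:2005.05142,
KiKimLee2009, CsordasSmithVarga1994). #3 DbnLowAllT — `∀ t > 0, ∀ z, H_t z = 0 → |Re z| < 6·10^{12}
→ Im z = 0`:
LOW zeros, from Platt–Trudgian RH-to-height, de Bruijn's monotone non-real count and a certified
barrier at
`Re z ≈ 6·10^{12}` for `t ∈ (0, 0.2]`, plus `Λ ≤ 0.2` for `t > 0.2` (why it might fail: not in print
as typed —
Polymath15 Thm 1.2 / Prop 3.3 control only `Im z ≥ sqrt(y0²+2(t0−t)) > 0`, no near-axis no-crossing
lemma, and the
printed barrier sits at `X = 5·10^{12}+194858`, not `6·10^{12}`; sources: arXiv:1904.12438 Thm 1.2,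
Prop 3.3,
Table 1 row 2; arXiv:2004.09765 Thm 1; Bruijn1950 Thm 13). Support: #4 DbnPerTFinite — per-`t`
finiteness
[KiKimLee2009 Thm 1.3], verbatim the fact Literature.NumberTheory.LFunctions.ki_kim_lee_finite,
which is now
DISCHARGED in the tree (`ki_kim_lee_finite_holds`, `XiHeatRayMonotone.lean`) — closes in one line;
the formal base
case of #2; #5
DbnNegativeLambdaPos (negative side) — `∃ t > 0, ¬ HasOnlyRealZeros (H_t)`, i.e. `Λ > 0` = ¬X,
staffed so refuters
can aim certified zero-tracking at it; #0 DbnThesis = X (target); #1 Assembly = X →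
`Summit.RiemannHypothesis`,
a hypothesis of `closes`, PROVED in the Literature
(`riemannHypothesis_of_hasOnlyRealZeros_deBruijnH_holds`,
`DeBruijnNewmanConstProofs.lean`): a prover closes it in one line from a Theorems file importing
that module (the
route file must not). #2 ∧ #3 → X is propositional (`Theorems/DBNDbnThesis.lean:
dbnThesis_of_dbnHighUniform_of_dbnLowAllT`).

KILL CRITERIA. (i) #5 proved (certified non-real zero of some `H_t`, `t > 0`) refutes X and RH. (ii)
A theorem that
any proof of #2 by heat-flow monotonicity must input zero-freeness of `H_0` above height `h(t) → ∞`
(formalising the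
Polymath15 p.31 obstruction remark) closes the route as a reformulation. (iii) #3 refuted ⇒ only a
threshold error:
re-file with the barrier height actually certified (e.g. the printed `X = 5·10^{12}+194858` of Table
1 row 2).

NOT DECOMPOSED YET. No ODE/PDE lemmas (zero velocity bounds, energy `Σ log|z_j - z_k|`), no barrier
certificate format (would use `Literature/Analysis/ValidatedNumerics/Certificate`), no `t ≥ 0.1`
rung; #2 is not
split until a `t`-pointwise dynamical mechanism with `t`-independent height is named; #3 is not
split into
"numerical RH at `t = 0`" / "barrier" / "near-axis no-nucleation" children until a prover's census
asks for it.

CHEAPEST FALSIFIER. Numerically track (uncertified first, then an argument-principle box count as in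
Polymath2019
§§6–7) the heat-flow images `z_j(t)`, `t ∈ (0, 0.2]`, of the ζ-zeros just above the Platt–Trudgian
height
(`|Re z|` slightly above `6·10^{12}`): one non-real zero of one `H_t` proves #5 and kills X; cheaper
still, a refuter
formalising the Polymath2019 p.31 obstruction as a theorem against #2 (kill criterion ii).

NUMBERS. Cone accounting (route-repair 2026-08-15): the deciding theorem and all six items use only
the definitions
`deBruijnH`, `HasOnlyRealZeros` (module `DeBruijnNewman`, whose named facts, like those of
`RiemannXi`, all carry
`_holds` discharges); NONE of `Literature.NumberTheory.LFunctions.platt_trudgian` (Λ ≤ 0.2),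
`Literature.NumberTheory.LFunctions.deBruijnNewmanConst_le` (its `sInf` form) or
`Literature.NumberTheory.LFunctions.JensenPolyaCriterion` (an RH-equivalent, foreign to this line)
is needed by the
route file; they rode in on `DeBruijnNewmanConstProofs → NewmanProofs → EquivalentsProofs →
Equivalents`, now not
imported. INSIDE proofs of #2/#3 the window `t > 1/5` is Platt–Trudgian Cor 2, which the tree
reduces
(`Literature.NumberTheory.LFunctions.platt_trudgian_of_numerics`, with the PROVED criteria
`Polymath15.upper_bound_criterion_holds` / `zero_free_region_criterion_holds`) to two computational
named facts:
F1 `Literature.NumberTheory.LFunctions.platt_trudgian_numerical_rh` (RH to height 3 000 175 332 800)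
and F3
`Literature.NumberTheory.LFunctions.Polymath15.table1_row2` (`FinalZeroFree ∧ BarrierZeroFree` at `X
= 5·10^{12}+194858`,
`t₀ = 0.186`, `y₀ = 0.16733`); #3 for `t ≤ 1/5` needs F1 as well. Provers state such partial results
with F1/F3
as explicit hypotheses in `--supports` lemmas and, if they are the last gap, end `blocked-on:` that
fact (it then
becomes tier-0 compute-certificate debt); the route itself names no `needs-fact`. `Λ ≤ 1/2` and
monotonicity are
proved (`hasOnlyRealZeros_deBruijnH_one_half_holds`, `mono_deBruijnH_holds`), so only `0 < t < 1/2`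
matters
(`Theorems/DBNDbnThesis.lean: dbnThesis_iff_of_lt_one_half`, `dbnThesis_iff_quadrant`).

Novelty: NOVELTY (thesis level; searches run 2026-08-14: `lit search "de Bruijn-Newman constant" --year-from
2019`, `lit frontier RiemannHypothesis --since 2021`, `lit bridges RiemannHypothesis --cross any`,
`lit vsearch`, reads of arXiv:1904.12438 pp.5,31 and arXiv:2005.05142 pp.2-5).
Nearest prior art found:
- Polymath2019 (arXiv:1904.12438): barrier criterion Thm 1.2 / Prop 3.3 (in tree, PROVED:
Literature.NumberTheory.LFunctions.Polymath15.upper_bound_criterion_holds,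
zero_free_region_criterion_holds), zero-free region x >= exp(C/t) for 0 < t <= 1/2 (Thm 1.5(i); fact
Literature.polymath15_zero_real_of_exp_div_le_re), Λ <= 0.22, and the §10 p.31 heuristic "unlikely
that one can significantly improve Λ <= O(1/log T) without being able to exclude significant
violations of RH at height T".
- PlattTrudgian2021 (arXiv:2004.09765): RH to height 3 000 175 332 800
(Literature.NumberTheory.LFunctions.platt_trudgian_numerical_rh), Cor 2 Λ <= 0.2
(Literature.NumberTheory.LFunctions.platt_trudgian; in-tree glue from Polymath15.table1_row2 at X =
5e12+194858, t0 = 0.186, y0 = 0.16733).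
- KiKimLee2009 (doi:10.1016/j.aim.2009.04.003): Λ < 1/2; for each t > 0 all but finitely many zeros
of H_t real and simple (Literature.NumberTheory.LFunctions.ki_kim_lee_finite), t-dependence
non-uniform and ineffective.
- CsordasSmithVarga1994: zero ODE dz_j/dt = 2 Σ' 1/(z_j - z_k), Lehmer pairs => lower bounds for Λ.
Bruijn1950 Thm 13 / Newman1976 Thm 3: monotonicity, existence of Λ.
- RodgersTao2020 (arXiv:180  [refs: 10.1016/j.aim.2009.04.003, 10.1016/j.cam.2025.117304, 1904.12438, 2005.05142, 2004.09765, 1801.05914, 1901.06596, 2509.18963, doi:10.1016/j.aim.2009.04.003, doi:10.1016/j.cam.2025.117304, Polymath2019, PlattTrudgian2021, KiKimLee2009, CsordasSmithVarga1994, Bruijn1950, Newman1976, RodgersTao2020, Dobner2020, NewmanWu2020]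

Barriers (technique_class: de-Bruijn-Newman backward-heat-flow; zero-dynamics; barrier): BARRIERS (catalogue Literature/Barriers/RiemannHypothesis/*, checked 2026-08-14):
- Literature.Barriers.RiemannHypothesis.NewmanConjecture (decl
Literature.Barriers.RiemannHypothesis.NewmanConjecture <->
Literature.NumberTheory.LFunctions.rodgers_tao; Λ >= 0, RodgersTao2020 Thm 1.1): applies as
SHARPNESS, not as a block. The route works on t > 0, the real-rooting direction of the flow, and the
barrier's scope caveat leaves t = 0 (= RH) untouched; but Λ >= 0 means X = "Λ <= 0" has zero margin:
DbnHighUniform as t -> 0+ is RH above height 3e12 with nothing to spare, so no argument needing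
slack in t (perturbing from the known t >= 0.2, compactness in t, 'RH with room to spare') can work.
Evasion: none; the bet is a t-pointwise dynamical argument with a t-independent height.
- Literature.Barriers.RiemannHypothesis.DavenportHeilbronn (decl
Literature.Barriers.RiemannHypothesis.DavenportHeilbronn: the Davenport-Heilbronn f — Dirichlet
series, entire, ζ-type functional equation, no Euler product — has infinitely many zeros in σ > 1;
Titchmarsh1986 §10.25): APPLIES to the mechanism. De Bruijn's flow, the zero ODE (Polymath2019 Prop
3.1), strip shrinking (Thm 3.2 =
Literature.NumberTheory.LFunctions.de_bruijn_strip_shrinking_holds), the barrier criterion and the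
exp(C/t) asymptotics use only extended-Selberg-class structure: Dobner2020 Thm 1 attaches a constant
Λ_F with the same theory to every F in S#, f included, and for f the thesis X is false (Λ_f > 0
since ξ^f has off-line zeros

Novelty grade: known — ROUTE-REVIEW grade (refuter-rreview1-DBN). KNOWN = reformulation: X ('H_t real-rooted ∀t>0' = Λ ≤ 0) is the textbook RH-equivalent (Rodgers–Tao §1); the HIGH/LOW split at 2×(Platt–Trudgian height) is Polymath15 Thm 1.2 geometry; no mechanism named ('NOT DECOMPOSED YET'; Novelty: 'Evasion: none'). Co (refuter refuter-rreview1-RiemannHypothesis-DBN-5625a712-0, 2026-08-15T18:30:28Z; prior: arXiv:1801.05914 (RodgersTao2020) §1 p.3: 'RH is then clearly equivalent to the upper bound Λ ≤ 0' — thesis X verbatim, arXiv:1904.12438 (Polymath2019) Thm 1.2 p.3 (barrier split at the verified height) and §10 p.31 (obstruction: Λ ≤ O(1/log T) needs excluding RH violations at height T), arXiv:2004.09765 (PlattTrudgian2021) Thm 1, Cor 2 (RH to 3 000 175 332 800; Λ ≤ 0.2), doi:10.1016/j.aim.2009.04)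

History (route lifecycle, newest last):
- 2026-08-24T00:08:58Z · DORMANT — reconciler: no traction for 6.4 d (last activity item-evidence-added at 2026-08-17T14:50:56Z); parked, not closed — `ledger route dormant route-RiemannHypothesi (operator:999:891259)
- 2026-08-25T19:02:09Z · REACTIVATED — D-0059: column DBN record-keeping at T0 = 3 000 175 332 800; pub-dbn-3 landing THEORY-R3 §6 T1 family (operator priority7 on director-rh 19:00:23Z; turnkey pack (operator:999:147264)
- 2026-08-29T21:04:35Z · DORMANT — census g0: costume (trib-confirmed census-trib-costume-B 2026-08-29; 21-frontier 19:16:23Z (b)); reversible --off (operator:999:1860635)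

sub-problem: RiemannHypothesis · status: dormant · opened planner-RiemannHypothesis-Survey-0 2026-08-13T06:08:46Z · rev 10 · ledger route-RiemannHypothesis-DBN
GENERATED by the gate from the ledger (D-0016/17). Provers cite these decls: `theorem foo : Summit.RiemannHypothesis.RiemannHypothesis.Theses.DBN.<Decl> := …` in Summits/RiemannHypothesis/RiemannHypothesis/Theorems/<Name>.lean.
-/

namespace Summit.RiemannHypothesis.RiemannHypothesis.Theses.DBN

open scoped BigOperators Topology Manifold Classical MeasureTheory ProbabilityTheory Matrix InnerProductSpace ComplexConjugate ContinuousMap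
open Filter Set Function TopologicalSpace MeasureTheory

attribute [summit_statement] _root_.Summit.RiemannHypothesis

open Summit

/-- item stmt-RiemannHypothesis-0274 · target · rank 0 · open · by planner
why it might fail: X <-> Λ <= 0 <-> RH, and Λ >= 0 (Rodgers-Tao Thm 1.1) leaves zero margin: one non-real zero of one H_t, t > 0 -- e.g. the heat-flow image of a hypothetical off-line zeta zero above the verified height 3*10^12 -- refutes X; known only for t >= 0.2 (Λ <= 0.2), open on 0 < t < 0.2.
sources: RodgersTao2020 Thm 1.1 (arXiv:1801.05914 p.3), PlattTrudgian2021 Thm 1, Cor 2 (arXiv:2004.09765), Literature.Barriers.RiemannHypothesis.NewmanConjecture, Literature.NumberTheory.LFunctions.platt_trudgian, Newman1976 Thm 3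
Thesis X of route DBN: de Bruijn's H_t (Literature.NumberTheory.LFunctions.deBruijnH, Rodgers–Tao
normalisation) has only real zeros for every t > 0. Equivalent to deBruijnNewmanConst ≤ 0
(Literature.NumberTheory.LFunctions.deBruijnNewmanConst_le_iff, fact) hence, with Rodgers–Tao Λ ≥ 0,
to Λ = 0 and to RH [Bruijn1950; Newman1976; RodgersTao2020]. -/
@[route_item "route-RiemannHypothesis-DBN", crux]
def DbnThesis : Prop :=
  ∀ t : ℝ, 0 < t → Literature.NumberTheory.LFunctions.HasOnlyRealZeros (Literature.NumberTheory.LFunctions.deBruijnH t)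

/-- item stmt-RiemannHypothesis-0278 · crux · rank 2 · open · by planner
why it might fail: t-uniform height is RH-strength: print has only x >= exp(C/t) (Polymath15 Thm 1.5(i)); p.31: an off-line zero at height T takes time ~1/log T to hit the axis, so small t must exclude RH violations near e^(C/t). Flow is Euler-product-blind: Dobner's Λ_F covers S#, incl. Davenport-Heilbronn (X false).
sources: Polymath2019 Thm 1.5(i) p.5 and §10 p.31 (arXiv:1904.12438), Literature.polymath15_zero_real_of_exp_div_le_re, KiKimLee2009 Thm 1.3 (doi:10.1016/j.aim.2009.04.003) = Literature.NumberTheory.LFunctions.ki_kim_lee_finite, Dobner2020 Thms 1-2, p.4 (arXiv:2005.05142), Literature.Barriers.RiemannHypothesis.DavenportHeilbronn, CsordasSmithVarga1994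
HIGH-zero half of X with the height split at 2 × (Platt–Trudgian RH height 3.0·10^12) in the
z-variable (z = 2γ − i(2β−1)). For each fixed t > 0 all but finitely many zeros are real
[KiKimLee2009 Thm 1.3]; for t ≥ 0.2 all zeros are real [PlattTrudgian2021 Cor 2, Polymath2019]. The
crux is uniformity as t → 0⁺, where the barrier method degenerates; needs a dynamical
(zero-repulsion ODE ż_j = 2Σ(z_j−z_k)^{-1} [CsordasSmithVarga1994]) or asymptotic argument with
t-independent height. Implied by RH. -/
@[route_item "route-RiemannHypothesis-DBN", crux]
def DbnHighUniform : Prop :=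
  ∀ t : ℝ, 0 < t → ∀ z : ℂ, Literature.NumberTheory.LFunctions.deBruijnH t z = 0 → 6000000000000 ≤ |z.re| → z.im = 0

/-- item stmt-RiemannHypothesis-0281 · crux · rank 3 · open · by planner
why it might fail: Not in print as typed: Polymath15 Thm 1.2/Prop 3.3 control only Im z >= sqrt(y0^2+2(t0-t)) > 0 and give Λ <= t0+y0^2/2, never 'Im z = 0 for |Re z| < X at each t <= t0'; non-real zeros crossing Re z = 6e12 below that floor are unexcluded (no drift lemma in print); barrier run is at X = 5e12+194858.
sources: Polymath2019 Thm 1.2, Prop 3.3, §10 Table 1 row 2 (arXiv:1904.12438 pp.3,9-10,31), Literature.NumberTheory.LFunctions.Polymath15.zero_free_region_criterion, Literature.NumberTheory.LFunctions.Polymath15.table1_row2, Literature.NumberTheory.LFunctions.de_bruijn_strip_shrinking_holds, PlattTrudgian2021 Thm 1 (arXiv:2004.09765) = Literature.NumberTheory.LFunctions.platt_trudgian_numerical_rh, Bruijn1950 Thm 13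
LOW-zero half of X. At t = 0 this is Platt–Trudgian numerical RH
(Literature.NumberTheory.LFunctions.platt_trudgian_numerical_rh, height 3 000 175 332 800 in γ, i.e.
|Re z| ≤ 6 000 350 665 600) with margin 3.5·10^8. For 0 < t ≤ 0.2: de Bruijn's theorem that the
number of non-real zeros (in a region no zero enters) is non-increasing in t [Bruijn1950 Thm 13;
CsordasSmithVarga1994] plus a certified zero-free barrier {6·10^12 ≤ Re z ≤ 6·10^12 + 1, 0 ≤ t ≤
0.2} in the style of [Polymath2019 §7; PlattTrudgian2021 §4]; for t > 0.2 all zeros are real (Λ ≤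
0.2). Essentially in print modulo re-running the barrier at this abscissa; certified-computation
target. -/
@[route_item "route-RiemannHypothesis-DBN", crux]
def DbnLowAllT : Prop :=
  ∀ t : ℝ, 0 < t → ∀ z : ℂ, Literature.NumberTheory.LFunctions.deBruijnH t z = 0 → |z.re| < 6000000000000 → z.im = 0

/-- item stmt-RiemannHypothesis-21560 · target · rank 6 · open · by planner
why it might fail: |a| < pi/8 is refuted in the barrier file; large |a| refutations need close zeta zero pairs at ever greater height (reach ~2/gap); an a-uniform theorem is open (NewmanConjecture.lean audit (iii)).
sources: Literature.Barriers.RiemannHypothesis.NewmanConjecture, CsordasSmithVarga1994, doi:10.1090/s0025-5718-1966-0203909-5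
[target] LINE L3 «LINEAR RAY HAS NO HYPERBOLIC MEMBER» (D-0145; ideator rh-idea-2; column DBN, new
N-P rung): the one-sided exponential smoothing G_a = (1 − D/a)⁻¹H_0
(Literature.Barriers.RiemannHypothesis.linearFactorH) is hyperbolic for NO a ≠ 0. The ray is
RH-STRENGTHENING (Splittings.LinearRayRh.riemannHypothesis_of_linearRay), so this target is RH-free
negative-side structure: it closes the «Hermitian non-even universal factor» branch of the
Laguerre–Pólya deformation class (NewmanConjecture.lean audit (i)–(iii)). Decomposition
(kernel-checked glue in the seat folder Sketch.lean `linearRayNonHyperbolic_of`, mirror symmetry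
hasOnlyRealZeros_linearFactorH_neg_iff): LinearRayRange21 (certified 0<|a|≤21, lane (xviii-D)) ∧
LinearRayLargeA (a>21) ⇒ this. Why it might fail: it fails iff some G_a, |a|>21, is hyperbolic —
which would PROVE RH; expected true (GUE: close zero pairs at all heights). Falsifier/instrument: a
certified hyperbolic member at some a>21 (eng-5). Sources:
Literature.Barriers.RiemannHypothesis.NewmanConjecture (audit §linear ray); CsordasSmithVarga1994;
KEYS-RH-LINES-D0145 L3. Nothing here bears on the truth of RH. -/
@[route_item "route-RiemannHypothesis-DBN"]
def LinearRayNonHyperbolic : Prop :=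
  ∀ a : ℝ, a ≠ 0 → ¬ Literature.NumberTheory.LFunctions.HasOnlyRealZeros (Literature.Barriers.RiemannHypothesis.linearFactorH a)

/-- item stmt-RiemannHypothesis-21579 · crux · rank 7 · open · by planner
why it might fail: Every known certificate has finite reach ~2/gap_x (B20 one- /two-point families); all a > 21 needs an unbounded schedule of ever-closer zeta zero pairs (GUE small-gap tail at all heights) or an a-uniform theorem; both open.
sources: Literature.Barriers.RiemannHypothesis.NewmanConjecture, doi:10.1090/s0025-5718-2011-02472-5, arXiv:1801.05914
[crux, rank 2 of LINE L3] the asymptotic regime: for every a > 21, G_a = (1 − D/a)⁻¹H_0 has a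
non-real zero (a>0 suffices by mirror symmetry). Why it might fail / why hard: B20
(Splittings.LinearRayFiniteReach.twoPoint_certificate_finite_reach,
onePoint_certificate_finite_reach): every fixed-point Laguerre certificate has finite reach a_max ≍
2/(x-gap of the pair), so (21,∞) needs an UNBOUNDED schedule of ever-closer zero pairs higher up, or
structure; as a theorem (under RH; ¬RH gives it free via riemannHypothesis_of_linearRay) it needs
consecutive zeta zeros of normalised gap ≲ 0.05 at all heights — GUE-generic, unknown (record liminf
0.5155 under RH, Preobrazhenskii 2016); NewmanConjecture.lean audit (iii): the a-uniform Gaussian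
kill (Λ ≥ 0, Rodgers–Tao) does not transfer (one-sided kernel, multiplier decays like 1/u). Attack
filed as LINE «quadrature-free dip schedule»: LinearRayDipCertificate ∧ LinearRayDipSupply ⇒ this
(glue `linearRayLargeA_of`, kernel-checked in seat Sketch.lean). Falsifier: a certified hyperbolic
G_a, a>21. Sources: CsordasSmithVarga1994; RodgersTao2020 (arXiv:1801.05914); arXiv:1508.05870
(Lehmer pairs revisited); doi:10.1090/s0025-5718-2011-02472-5. Not -/
@[route_item "route-RiemannHypothesis-DBN"]
def LinearRayLargeA : Prop :=
  ∀ a : ℝ, 21 < a → ¬ Literature.NumberTheory.LFunctions.HasOnlyRealZeros (Literature.Barriers.RiemannHypothesis.linearFactorH a)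

/-- item stmt-RiemannHypothesis-21603 · crux · rank 7 · open · by planner
why it might fail: Needs for every a > 21 a dip of sigma*Re H_0 whose certificate covers a; reach per dip ~1.6/gap_x, so a -> oo needs normalised zeta gaps -> 0 with controlled f''' and tail at all heights: the GUE small-gap tail, unproved (best: liminf <= 0.50 under RH, Preobrazhenskii).
sources: doi:10.1090/s0025-5718-2011-02472-5, arXiv:1610.09497, Literature.Barriers.RiemannHypothesis.NewmanConjecture
[crux, rank 2 of LINE «QUADRATURE-FREE DIP SCHEDULE»] DIP SUPPLY: for every a > 21 the real axis of
H_0 carries a dip/bump satisfying the hypotheses of LinearRayDipCertificate with a ∈ [a₁,a₂] —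
«ξ(1/2+it) has arbitrarily sharp, shape-regular, one-side-isolated dips». With
LinearRayDipCertificate it gives LinearRayLargeA (glue `linearRayLargeA_of`, kernel-checked in seat
Sketch.lean), hence L3. THE OBJECT HANDED TO THE SEARCH (D-0116): the set of consecutive
critical-line zero pairs (γ,γ') with a₂(pair) ≈ 2·sqrt(1−ε)/(2(γ'−γ)) and a₁(pair) ≈ max(2/ℓ,
log-tail) — coverage of (21,∞) by the intervals [a₁,a₂] of certified pairs. Why it might fail:
needs, at ALL heights T, consecutive zeta zeros with normalised gap μ ≲ 0.05 whose next gap is ≳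
average and with bounded local curvature drift (M₃/F₂ ≲ a₁/10): GUE-generic (density ∝ μ²) but
unproved even under RH (record: liminf μ ≤ 0.5155, Preobrazhenskii 2016; Λ ≥ 0 of Rodgers–Tao does
not transfer, NewmanConjecture.lean audit (iii)); a proof would be new information on small gaps of
ζ; a refutation (no sharp dips above some height) would contradict GUE. Falsifier/instrument: per
rung, certified dip data (eng-5 Φ-quadrature to x ≈ 1.5·10⁵ -/
@[route_item "route-RiemannHypothesis-DBN"]
def LinearRayDipSupply : Prop :=
  ∀ a : ℝ, 21 < a → ∃ (σ x x' ℓ a₁ a₂ d F₁ F₂ M₃ P B : ℝ), (σ = 1 ∨ σ = -1) ∧ 0 ≤ x ∧ x < x' ∧ 0 < ℓ ∧ 0 < a₁ ∧ 2 ≤ a₁ * ℓ ∧ a₁ ≤ a₂ ∧ 0 ≤ B ∧ 0 < σ * (Literature.NumberTheory.LFunctions.deBruijnH 0 ((x : ℝ) : ℂ)).re ∧ σ * (Literature.NumberTheory.LFunctions.deBruijnH 0 ((x' : ℝ) : ℂ)).re < 0 ∧ -d ≤ σ * (Literature.NumberTheory.LFunctions.deBruijnH 0 ((x' : ℝ)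 : ℂ)).re ∧ |(Literature.NumberTheory.LFunctions.deBruijnH0Deriv 1 ((x' : ℝ) : ℂ)).re| ≤ F₁ ∧ F₂ ≤ σ * (Literature.NumberTheory.LFunctions.deBruijnH0Deriv 2 ((x' : ℝ) : ℂ)).re ∧ (∀ t ∈ Set.Icc x (x' + ℓ), |(Literature.NumberTheory.LFunctions.deBruijnH0Deriv 3 ((t : ℝ) : ℂ)).re| ≤ M₃) ∧ (∀ t ∈ Set.Icc (x + ℓ) (x' + ℓ), |(Literature.NumberTheory.LFunctions.deBruijnH0Deriv 0 ((t : ℝ) : ℂ)).re| + |(Literature.NumberTheory.LFunctions.deBruijnH0Deriv 1 ((t : ℝ) : ℂ)).re| / a₁ + |(Literature.NumberTheory.LFunctions.deBruijnH0Deriv 2 ((t : ℝ) : ℂ)).re| / a₁ ^ 2 ≤ P) ∧ (∀ t : ℝ, x + ℓ ≤ t → -B ≤ σ * (Literature.NumberTheory.LFunctions.deBruijnH 0 ((t : ℝ) : ℂ)).re) ∧ 2 * a₂ ^ 2 * d + 2 * F₁ * (a₂ + a₂ ^ 2 * (x' - x)) + M₃ * (a₂ ^ 2 * (x' - x) ^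 3 / 3 + a₂ * (x' - x) ^ 2 + 2 * (x' - x) + 2 / a₁) + 2 * a₁ ^ 2 * Real.exp (-(a₁ * ℓ)) * (P + B) < F₂ ∧ a₁ ≤ a ∧ a ≤ a₂

/-- item stmt-RiemannHypothesis-22394 · crux · rank 7 · open · by planner
why it might fail: Moment methods lose log T: the 4th moment of the AFE-midpoint window sum carries the n1n4=n2n3 factor log N, and the union bound over {filtered Z small}, {|Z| > log T/C on the gap}, {long gap} fails by constants growing with a; needs decorrelation of the n~N window from large values of zeta.
sources: Gonek1984 Invent. Math. 75, arXiv:math/0612106, Fujii1975 Proc. Japan Acad. 51, doi:10.1090/s0025-5718-2011-02472-5, Summits/RiemannHypothesis/RiemannHypothesis/Theorems/UniversalFactorNarrowKernelNoGo.lean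
[crux, OPEN (analytic number theory, RH may be assumed); LINE 3 «TWO-RAY LAGUERRE SQUEEZE» supply
(rh-idea-2, D-0145)] STATEMENT: for every a > 21, under RH, there is ONE pair of consecutive simple
real zeros x₁<x₂ of H_0 (= 2γ, 2γ' for consecutive zeta ordinates) with a(x₂−x₁) ≤ 1 on which the
two-sided factor is NOT squeezed: |Re F_a(y)| > a(x₂−x₁)|Re H_0(y)| for all y ∈ [x₁,x₂]. WHY
PLAUSIBLE: at height T with log T ≫ a, a TYPICAL gap has x₂−x₁ ≈ 4π/log T, F_a(2t)·w(t) ≈ the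
Lorentz-filtered Hardy function (log-free mean square ≍ a: tree stubs UniversalFactor
narrowEnergyLower/Upper, Theorems/UniversalFactorNarrowKernelNoGo*.lean) is of size ≍ √a while |H_0
w| = |Z| is of size e^{O(√loglog T)} on the gap, so the inequality holds by a factor ≍ log
T/(a^{1/2}·|Z|) at most gaps; it fails only where the filtered Z is abnormally small AND/OR |Z|
abnormally large on an abnormally long gap. Unlike LinearRayDipSupply (LINE 2) this needs NO rare
close pair — one typical gap at height e^{O(a)} — so it is a target for mean-value THEORY (discrete
mean values of the filtered Dirichlet polynomial Σ n^{-1/2-iγ} k̂(log(N/n)) at zeros,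
Gonek/Montgomery-type; measure of large values of ζ and of l -/
@[route_item "route-RiemannHypothesis-DBN", crux]
def TypicalGapSqueezeSupply : Prop :=
  ∀ a : ℝ, 21 < a → RiemannHypothesis → ∃ x₁ x₂ : ℝ, x₁ < x₂ ∧ a * (x₂ - x₁) ≤ 1 ∧ Literature.NumberTheory.LFunctions.deBruijnH 0 ((x₁ : ℝ) : ℂ) = 0 ∧ Literature.NumberTheory.LFunctions.deBruijnH 0 ((x₂ : ℝ) : ℂ) = 0 ∧ Literature.NumberTheory.LFunctions.deBruijnH0Deriv 1 ((x₁ : ℝ) : ℂ) ≠ 0 ∧ Literature.NumberTheory.LFunctions.deBruijnH0Deriv 1 ((x₂ : ℝ) : ℂ) ≠ 0 ∧ (∀ z ∈ Set.Ioo x₁ x₂, Literature.NumberTheory.LFunctions.deBruijnH 0 ((z : ℝ) : ℂ) ≠ 0) ∧ ∀ y ∈ Set.Icc x₁ x₂, a * (x₂ - x₁) * |(Literature.NumberTheory.LFunctions.deBruijnH 0 ((y : ℝ) : ℂ)).re| < |(Literature.NumberTheory.LFunctions.deBruijnHDiv (fun u : ℝ => 1 + u ^ 2 / a ^ 2) ((y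 : ℝ) : ℂ)).re|

/-- item stmt-RiemannHypothesis-0282 · support · rank 4 · closed · proved by Summit.RiemannHypothesis.RiemannHypothesis.Theorems.dbnPerTFinite_proof' (prover) · by planner
sources: KiKimLee2009 Thm 1.3, Literature.NumberTheory.LFunctions.ki_kim_lee_finite, Literature.polymath15_zero_real_of_exp_div_le_re, Polymath2019 Thm 1.5(i) (arXiv:1904.12438 p.5)
Per-t base case of #2: for every t > 0, H_t has at most finitely many non-real zeros [KiKimLee2009
Thm 1.3] (their proof: saddle-point asymptotics of H_t and the argument principle). Theorem in
print; grounder may vendor as fact ki_kim_lee_finite, in which case #2 reads: the threshold T(t) can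
be taken = 6·10^12 for all t > 0. -/
@[route_item "route-RiemannHypothesis-DBN"]
def DbnPerTFinite : Prop :=
  ∀ t : ℝ, 0 < t → ∃ T : ℝ, ∀ z : ℂ, Literature.NumberTheory.LFunctions.deBruijnH t z = 0 → T ≤ |z.re| → z.im = 0

-- `DbnPerTFinite` holds: proved by `Summit.RiemannHypothesis.RiemannHypothesis.Theorems.dbnPerTFinite_proof'` (its module imports this route file, so no `_holds` link can be stated here).

/-- item stmt-RiemannHypothesis-0283 · support · rank 5 · open · by planner
why it might fail: It is ¬X, i.e. Λ > 0, i.e. ¬RH given the DBN facts: false iff RH. No witness: all computed zeros of H_t (Polymath15, t <= 0.5) are real, and Rodgers-Tao obtain Λ >= 0 only from infinitely many ever-better Lehmer pairs -- no single pair or explicit t > 0 gives a non-real zero to track.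
sources: RodgersTao2020 Thm 1.1 and §1 (arXiv:1801.05914 p.3), Newman1976 Remark 2, CsordasSmithVarga1994, Polymath2019 §10
Negation of thesis X: some H_t, t > 0, has a non-real zero, i.e. deBruijnNewmanConst > 0; equivalent
to ¬RH given the DBN facts. Rodgers–Tao's theorem Λ ≥ 0 ('RH, if true, is barely so'
[RodgersTao2020; Newman1976]) makes this the natural refutation target: a certified non-real zero of
H_t for one explicit t > 0 (tracked from a Lehmer pair [CsordasSmithVarga1994]) would settle it.
Filed so the negative side is staffed. -/
@[route_item "route-RiemannHypothesis-DBN"]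
def DbnNegativeLambdaPos : Prop :=
  ∃ t : ℝ, 0 < t ∧ ¬ Literature.NumberTheory.LFunctions.HasOnlyRealZeros (Literature.NumberTheory.LFunctions.deBruijnH t)

/-- item stmt-RiemannHypothesis-21602 · support · rank 8 · closed · proved by Summit.RiemannHypothesis.RiemannHypothesis.Theorems.Splittings.LinearRayDipCertificate.linearRayDipCertificate (prover) · by planner
[support, PROVABLE NOW — prover target #1 of LINE «QUADRATURE-FREE DIP SCHEDULE» (a>21; ideator
rh-idea-2, D-0145, instrument-design)] The dip certificate with an explicit a-INTERVAL: at a dip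
(σ=1: H_0(x)>0>H_0(x'), H_0''(x') ≥ F₂ > 0) or bump (σ=−1) of H_0 = deBruijnH 0 on [0,∞), six
certified numbers — depth d and slope bound F₁ at x', curvature floor F₂ at x', M₃ ≥ |H_0'''| on [x,
x'+ℓ], boundary bound P on [x+ℓ, x'+ℓ], one-sided tail bound B beyond x+ℓ — and ONE margin
inequality refute the ray for EVERY a ∈ [a₁,a₂] (sharp on the parabola model: a₂·gap < 2; no
quadrature of Q_a, no a-cells). Proof (M-sized, all tools in tree): a·Q_a(s) = a∫₀^ℓ
e^{−at}H_0(s+t)dt + tail; three integrations by parts (LinearRayFiniteReachLaplace.laplaceFwd_ibp,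
re_fwdAvg_eq) give H_0(s)+H_0'(s)/a+H_0''(s)/a² + (1/a²)∫₀^ℓ e^{−at}H_0''' − e^{−aℓ}[…](s+ℓ); cubic
Taylor at x' with |H_0'''| ≤ M₃ gives ≥ F₂/(2a²) − d − F₁(1/a+W) − M₃(W³/6+W²/(2a)+W/a²+1/a³) −
e^{−aℓ}(P+B), W = x'−x; multiply by 2a²; every error term is monotone in a on [a₁,a₂] (a ↦ a²e^{−aℓ}
decreasing for aℓ ≥ 2) ⇒ Q_a > 0 (σ=1) / < 0 (σ=−1) on [x,x'] ⇒
LinearRayTwoPoint.not_linearRay_of_signChange / …'. Why it matters: turns B20's qua -/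
@[route_item "route-RiemannHypothesis-DBN"]
def LinearRayDipCertificate : Prop :=
  ∀ (σ x x' ℓ a₁ a₂ d F₁ F₂ M₃ P B : ℝ), (σ = 1 ∨ σ = -1) → 0 ≤ x → x < x' → 0 < ℓ → 0 < a₁ → 2 ≤ a₁ * ℓ → a₁ ≤ a₂ → 0 ≤ B → 0 < σ * (Literature.NumberTheory.LFunctions.deBruijnH 0 ((x : ℝ) : ℂ)).re → σ * (Literature.NumberTheory.LFunctions.deBruijnH 0 ((x' : ℝ) : ℂ)).re < 0 → -d ≤ σ * (Literature.NumberTheory.LFunctions.deBruijnH 0 ((x' : ℝ) : ℂ)).re → |(Literature.NumberTheory.LFunctions.deBruijnH0Deriv 1 ((x' : ℝ) : ℂ)).re| ≤ F₁ → F₂ ≤ σ * (Literature.NumberTheory.LFunctions.deBruijnH0Deriv 2 ((x' : ℝ) : ℂ)).re → (∀ t ∈ Set.Icc x (x' + ℓ), |(Literature.NumberTheory.LFunctions.deBruijnH0Deriv 3 ((t : ℝ) : ℂ)).re| ≤ M₃) → (∀ t ∈ Set.Icc (x + ℓ) (x' + ℓ), |(Literature.NumberTheory.LFunctions.deBruijnH0Deriv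 0 ((t : ℝ) : ℂ)).re| + |(Literature.NumberTheory.LFunctions.deBruijnH0Deriv 1 ((t : ℝ) : ℂ)).re| / a₁ + |(Literature.NumberTheory.LFunctions.deBruijnH0Deriv 2 ((t : ℝ) : ℂ)).re| / a₁ ^ 2 ≤ P) → (∀ t : ℝ, x + ℓ ≤ t → -B ≤ σ * (Literature.NumberTheory.LFunctions.deBruijnH 0 ((t : ℝ) : ℂ)).re) → 2 * a₂ ^ 2 * d + 2 * F₁ * (a₂ + a₂ ^ 2 * (x' - x)) + M₃ * (a₂ ^ 2 * (x' - x) ^ 3 / 3 + a₂ * (x' - x) ^ 2 + 2 * (x' - x) + 2 / a₁) + 2 * a₁ ^ 2 * Real.exp (-(a₁ * ℓ)) * (P + B) < F₂ → ∀ a ∈ Set.Icc a₁ a₂, ¬ Literature.NumberTheory.LFunctions.HasOnlyRealZeros (Literature.Barriers.RiemannHypothesis.linearFactorH a)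

/-- `LinearRayDipCertificate` holds: proved by `Summit.RiemannHypothesis.RiemannHypothesis.Theorems.Splittings.LinearRayDipCertificate.linearRayDipCertificate`. -/
theorem LinearRayDipCertificate_holds : LinearRayDipCertificate := _root_.Summit.RiemannHypothesis.RiemannHypothesis.Theorems.Splittings.LinearRayDipCertificate.linearRayDipCertificate

/-- item stmt-RiemannHypothesis-22393 · support · rank 8 · closed · proved by Summit.RiemannHypothesis.RiemannHypothesis.Theorems.Splittings.LinearRaySwing.linearRaySwingLemma_proof (prover) · by planner
[support, PROVABLE NOW, pure real analysis ~300-500 lines; LINE 3 «TWO-RAY LAGUERRE SQUEEZE»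
(rh-idea-2, D-0145)] STATEMENT: under Ray(a), a > 0, for consecutive SIMPLE real zeros x₁ < x₂ of
H_0 (no zero in between) with a(x₂−x₁) ≤ 1, somewhere on [x₁,x₂] the two-sided factor is squeezed: ∃
y, |Re F_a(y)| ≤ a(x₂−x₁)|Re H_0(y)|, F_a = deBruijnHDiv(1+u²/a²). PROOF SKETCH: F := Re F_a on ℝ is
C^∞ with F'' = a²(F − H_0) (deBruijnHDiv_laplace_sub_deriv_deriv); G_± := Re linearFactorH(±a) = F ±
F'/a. If F vanishes on [x₁,x₂] take y there. Else WLOG F > 0 (everything is odd under H_0 ↦ −H_0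
formally: treat F < 0 symmetrically), u := log F. By LinearRayMirrorSqueeze-type sign rules
(G_+·H_0' ≥ 0 ≥ G_−·H_0' at x_i, from laguerre_rayG for ±a): if H_0'(x₁) > 0 then F'(x₁) = (a/2)(G_+
− G_−)(x₁) ≥ a F(x₁), and H_0 > 0 on (x₁,x₂) forces H_0'(x₂) < 0 hence F'(x₂) ≤ −aF(x₂): u' ≥ a at
x₁, u' ≤ −a at x₂. Let t₁ = last point with u' ≥ a, t₂ = first point after t₁ with u' ≤ −a; on
(t₁,t₂) |u'| < a and by the MVT ∃ y with u''(y) ≤ −2a/(t₂−t₁) ≤ −2a/δ, δ = x₂−x₁. Since u'' = F''/F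
− u'² = a²(1 − H_0/F) − u'², at y: a²H_0(y)/F(y) ≥ 2a/δ, i.e. F(y) ≤ (aδ/2)H_0(y). If instead
H_0'(x₁) < 0 (H_0 < 0 on the -/
@[route_item "route-RiemannHypothesis-DBN"]
def LinearRaySwingLemma : Prop :=
  ∀ a : ℝ, 0 < a → Literature.NumberTheory.LFunctions.HasOnlyRealZeros (Literature.Barriers.RiemannHypothesis.linearFactorH a) → ∀ x₁ x₂ : ℝ, x₁ < x₂ → a * (x₂ - x₁) ≤ 1 → Literature.NumberTheory.LFunctions.deBruijnH 0 ((x₁ : ℝ) : ℂ) = 0 → Literature.NumberTheory.LFunctions.deBruijnH 0 ((x₂ : ℝ) : ℂ) = 0 → Literature.NumberTheory.LFunctions.deBruijnH0Deriv 1 ((x₁ : ℝ) : ℂ) ≠ 0 → Literature.NumberTheory.LFunctions.deBruijnH0Deriv 1 ((x₂ : ℝ) : ℂ) ≠ 0 → (∀ z ∈ Set.Ioo x₁ x₂, Literature.NumberTheory.LFunctions.deBruijnH 0 ((z : ℝ) : ℂ) ≠ 0) → ∃ y ∈ Set.Icc x₁ x₂, |(Literature.NumberTheory.LFunctions.deBruijnHDiv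 (fun u : ℝ => 1 + u ^ 2 / a ^ 2) ((y : ℝ) : ℂ)).re| ≤ a * (x₂ - x₁) * |(Literature.NumberTheory.LFunctions.deBruijnH 0 ((y : ℝ) : ℂ)).re|

-- `LinearRaySwingLemma` holds: proved by `Summit.RiemannHypothesis.RiemannHypothesis.Theorems.Splittings.LinearRaySwing.linearRaySwingLemma_proof` (its module imports this route file, so no `_holds` link can be stated here).

/-- item stmt-RiemannHypothesis-18758 · support · rank 9 · closed · proved by Summit.RiemannHypothesis.RiemannHypothesis.Theorems.DbnTheory.BoundaryReduction_holds @ 8fb402316d86 (prover) · by operator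
[support] T1a — for smeared signed multi-probe kernels k = Σ wᵢ S_{cᵢ,κᵢ,uᵢ} read ABOVE the top zero
(1 < cᵢ, κᵢ ≥ 0), 2-D admissibility (K) `k ≤ P on ℝ × [0,1] ∖ {(0,1)}` (P = descent kernel) is
EQUIVALENT to the boundary inequality `k(ξ,1) ≤ 4/(ξ²+4)` for all ξ (maximum principle for the
harmonic function P − k on the strip |η| < 1; THEORY-R1 §2, proof route THEORY-R3 §6 via the
ε-regularised kernel + Phragmén–Lindelöf). PROVED on the farm by pub-dbn-3 g15
(`BoundaryReduction_holds`, rc 0 / 0 sorries / standard axioms, STATUS 2026-08-25T18:16Z); tree file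
`Theorems/DBNBoundaryReduction.lean` landing (waits on oleans) — closer = `theorem … :
Theses.DBN.DbnBoundaryReduction := DbnTheory.BoundaryReduction_holds` filed `--workitem <this
item>`, or `ledger workitem close <item> --as proved --by …BoundaryReduction_holds`. RH-FREE (pure
real/complex analysis of the two kernels of the 2001 dynamic Λ-certificate's descent lemma, resp. of
the finite Csordas–Smith–Varga zero dynamics; no ζ, no H_t, no zeros-to-height input). SHARPENS
DbnHighUniform / DbnPerTFinite (it is a lemma of the dynamic method by which column DBN of the RH
ladder records Λ-bounds from verified height — D-0040, RECORD -/
@[route_item "route-RiemannHypothesis-DBN"]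
def DbnBoundaryReduction : Prop :=
  Summit.RiemannHypothesis.RiemannHypothesis.Theorems.DbnTheory.BoundaryReduction

/-- `DbnBoundaryReduction` holds: proved by `Summit.RiemannHypothesis.RiemannHypothesis.Theorems.DbnTheory.BoundaryReduction_holds` @ 8fb402316d86. -/
theorem DbnBoundaryReduction_holds : DbnBoundaryReduction := _root_.Summit.RiemannHypothesis.RiemannHypothesis.Theorems.DbnTheory.BoundaryReduction_holds

/-- item stmt-RiemannHypothesis-18759 · support · rank 9 · closed · proved by Summit.RiemannHypothesis.RiemannHypothesis.Theorems.DbnTheory.BoundaryReductionEps_holds @ 8fb402316d86 (prover) · by operator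
[support] T1a-ε — with the descent kernel's poles moved to (0, ±(1+ε)) (`descentKernelEps`, ε > 0):
if the signed kernel is dominated by P_ε + δ on BOTH boundary lines η = ±1 then it is dominated by
P_ε + δ on the whole closed strip |η| ≤ 1 (Phragmén–Lindelöf applied to exp(K − Π_ε − δ), Re K = k,
Re Π_ε = P_ε; THEORY-R3 §6 — the lemma from which T1a follows by ε → 0⁺). PROVED on the farm by
pub-dbn-3 g15 (`BoundaryReductionEps_holds`, STATUS 18:16Z; holomorphy of the parametric probe
integral = tree file `Theorems/DBNKernelHolomorphy.lean`, 18:51Z); closer as for T1a with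
`…BoundaryReductionEps_holds`. RH-FREE (pure real/complex analysis of the two kernels of the 2001
dynamic Λ-certificate's descent lemma, resp. of the finite Csordas–Smith–Varga zero dynamics; no ζ,
no H_t, no zeros-to-height input). SHARPENS DbnHighUniform / DbnPerTFinite (it is a lemma of the
dynamic method by which column DBN of the RH ladder records Λ-bounds from verified height — D-0040,
RECORD-KEEPING at T₀ = 3 000 175 332 800), LOWERS NOTHING: it neither implies RH nor enters
`closes`/`Assembly` (Λ ≤ 0 ⇔ RH stays the declared door; Rodgers–Tao Λ ≥ 0, rodgers_tao). Bears
ladder rung N-P (HUMAN RULING D-0059, -/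
@[route_item "route-RiemannHypothesis-DBN"]
def DbnBoundaryReductionEps : Prop :=
  Summit.RiemannHypothesis.RiemannHypothesis.Theorems.DbnTheory.BoundaryReductionEps

/-- `DbnBoundaryReductionEps` holds: proved by `Summit.RiemannHypothesis.RiemannHypothesis.Theorems.DbnTheory.BoundaryReductionEps_holds` @ 8fb402316d86. -/
theorem DbnBoundaryReductionEps_holds : DbnBoundaryReductionEps := _root_.Summit.RiemannHypothesis.RiemannHypothesis.Theorems.DbnTheory.BoundaryReductionEps_holds

/-- item stmt-RiemannHypothesis-18760 · support · rank 9 · closed · proved by Summit.RiemannHypothesis.RiemannHypothesis.Theorems.DbnTheory.ProbeMass_holds (prover) · by operator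
[support] T1b — one biweight-smeared probe kernel has total mass 2π on the boundary line η = 1,
independently of c > 1, κ ≥ 0, u (Fubini over the biweight + the Poisson mass ∫ a/(x²+a²) = π;
THEORY-R1 §2). Together with `DescentMass` (∫ 4/(ξ²+4) = 2π — `DbnTheory.DescentMass_holds`, same
file, folded into this item rather than filed separately: cap 15) it is the Gauss-law behind the
net-weight ceiling T1c and the probe-class wall N1. PROVED IN TREE: `Theorems/DBNKernelMasses.lean`,
`DbnTheory.ProbeMass_holds` (landed 2026-08-25T18:32Z, ref2 PASS) — closer = one line `theorem … :
Theses.DBN.DbnProbeMass := DbnTheory.ProbeMass_holds` (`--workitem <item>`) or `ledger workitem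
close <item> --as proved --by
Summit.RiemannHypothesis.RiemannHypothesis.Theorems.DbnTheory.ProbeMass_holds`. RH-FREE (pure
real/complex analysis of the two kernels of the 2001 dynamic Λ-certificate's descent lemma, resp. of
the finite Csordas–Smith–Varga zero dynamics; no ζ, no H_t, no zeros-to-height input). SHARPENS
DbnHighUniform / DbnPerTFinite (it is a lemma of the dynamic method by which column DBN of the RH
ladder records Λ-bounds from verified height — D-0040, RECORD-KEEPING at T₀ = 3 000 175 332 800), L -/
@[route_item "route-RiemannHypothesis-DBN"]
def DbnProbeMass : Prop :=
  Summit.RiemannHypothesis.RiemannHypothesis.Theorems.DbnTheory.ProbeMass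

/-- `DbnProbeMass` holds: proved by `Summit.RiemannHypothesis.RiemannHypothesis.Theorems.DbnTheory.ProbeMass_holds`. -/
theorem DbnProbeMass_holds : DbnProbeMass := _root_.Summit.RiemannHypothesis.RiemannHypothesis.Theorems.DbnTheory.ProbeMass_holds

/-- item stmt-RiemannHypothesis-18761 · support · rank 9 · closed · proved by Summit.RiemannHypothesis.RiemannHypothesis.Theorems.DbnTheory.NetWeightCeiling_holds (prover) · by operator
[support] T1c — if k = Σ wᵢ S_{cᵢ,κᵢ,uᵢ} (1 < cᵢ, κᵢ ≥ 0, weights of either sign) satisfies the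
boundary inequality k(ξ,1) ≤ 4/(ξ²+4) for all ξ, then its net weight W = Σ wᵢ is at most 1
(integrate, using T1b and DescentMass: 2πW ≤ 2π). This is the RH-free content of wall (W) of the
theory memos: signed / multi-height probe designs cannot beat the single probe's net pull (THEORY-R1
§2–3, R2 E1–E3). PROVED IN TREE: `Theorems/DBNKernelMasses.lean`, `DbnTheory.NetWeightCeiling_holds`
(18:32Z) — closer one line / `workitem close --as proved --by …NetWeightCeiling_holds`. RH-FREE
(pure real/complex analysis of the two kernels of the 2001 dynamic Λ-certificate's descent lemma,
resp. of the finite Csordas–Smith–Varga zero dynamics; no ζ, no H_t, no zeros-to-height input).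
SHARPENS DbnHighUniform / DbnPerTFinite (it is a lemma of the dynamic method by which column DBN of
the RH ladder records Λ-bounds from verified height — D-0040, RECORD-KEEPING at T₀ = 3 000 175 332
800), LOWERS NOTHING: it neither implies RH nor enters `closes`/`Assembly` (Λ ≤ 0 ⇔ RH stays the
declared door; Rodgers–Tao Λ ≥ 0, rodgers_tao). Bears ladder rung N-P (HUMAN RULING D-0059,
director-rh 2026-08-25T18:39:06Z). S -/
@[route_item "route-RiemannHypothesis-DBN"]
def DbnNetWeightCeiling : Prop :=
  Summit.RiemannHypothesis.RiemannHypothesis.Theorems.DbnTheory.NetWeightCeiling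

/-- `DbnNetWeightCeiling` holds: proved by `Summit.RiemannHypothesis.RiemannHypothesis.Theorems.DbnTheory.NetWeightCeiling_holds`. -/
theorem DbnNetWeightCeiling_holds : DbnNetWeightCeiling := _root_.Summit.RiemannHypothesis.RiemannHypothesis.Theorems.DbnTheory.NetWeightCeiling_holds

/-- item stmt-RiemannHypothesis-18762 · support · rank 9 · closed · proved by Summit.RiemannHypothesis.RiemannHypothesis.Theorems.dbnDoubleRowInvisibility_closed @ 1d3b5665d0f6 (prover) · by operator
[support] N1 — for 0 < Y < ys: a detector at height ys receives total mass 2π from a zero pair at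
heights ±Y — the same as from two real zeros (∫ ys/(u²+ys²) = π each) — while the pull on a zero at
height Y is 4Y/(u²+4Y²) per pair (mass 2π) against 2·2Y/(u²+Y²) (mass 4π) for two real zeros: probes
above the top zero cannot distinguish a double row from real zeros, the Gauss-law obstruction (N1)
that caps every probe-class certificate (THEORY-R1 §3). PROVED IN TREE:
`Theorems/DBNKernelMasses.lean`, `DbnTheory.DoubleRowInvisibility_holds` (18:32Z) — closer one line
/ `workitem close --as proved --by …DoubleRowInvisibility_holds`. RH-FREE (pure real/complex
analysis of the two kernels of the 2001 dynamic Λ-certificate's descent lemma, resp. of the finite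
Csordas–Smith–Varga zero dynamics; no ζ, no H_t, no zeros-to-height input). SHARPENS DbnHighUniform
/ DbnPerTFinite (it is a lemma of the dynamic method by which column DBN of the RH ladder records
Λ-bounds from verified height — D-0040, RECORD-KEEPING at T₀ = 3 000 175 332 800), LOWERS NOTHING:
it neither implies RH nor enters `closes`/`Assembly` (Λ ≤ 0 ⇔ RH stays the declared door;
Rodgers–Tao Λ ≥ 0, rodgers_tao). Bears ladder rung -/
@[route_item "route-RiemannHypothesis-DBN"]
def DbnDoubleRowInvisibility : Prop :=
  Summit.RiemannHypothesis.RiemannHypothesis.Theorems.DbnTheory.DoubleRowInvisibility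

-- `DbnDoubleRowInvisibility` holds: proved by `Summit.RiemannHypothesis.RiemannHypothesis.Theorems.dbnDoubleRowInvisibility_closed` @ 1d3b5665d0f6 (its module imports this route file, so no `_holds` link can be stated here).

/-- item stmt-RiemannHypothesis-18763 · support · rank 9 · closed · proved by Summit.RiemannHypothesis.RiemannHypothesis.Theorems.DbnTheory.ClassFloorExitTime_holds (prover) · by operator
[support] T3 — ODE comparison: an envelope Y, continuous on [0,T], positive on [0,T), Y(0) = Y₀ > 0,
Y(T) = 0, differentiable on (0,T) with derivative never below the idealised class rate −(1/Y + ℓ/4)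
(ℓ > 0), satisfies classFloor ℓ Y₀ = (4/ℓ)(Y₀ − (4/ℓ) log(1 + ℓY₀/4)) ≤ T (d/dt G(Y(t)) ≥ −1 for the
potential G = classPotential, whose derivative y/(1+ℓy/4) is T3s `ClassPotentialDeriv` —
`DbnTheory.ClassPotentialDeriv_holds`, folded into this item rather than filed separately: cap 15).
It is the RH-free half of the statement ‘the probe class cannot certify below ≈ 0.102 at T₀’ (the
other half, that admissible certificates descend no faster than the class rate, is T1c + N1 + the
MODEL calibration of THEORY-R1 §3 and is NOT claimed here). PROVED IN TREE:
`Theorems/DBNClassFloor.lean`, `DbnTheory.ClassFloorExitTime_holds` (file in tree 2026-08-25T18:33Z)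
— closer one line / `workitem close --as proved --by …ClassFloorExitTime_holds`. RH-FREE (pure
real/complex analysis of the two kernels of the 2001 dynamic Λ-certificate's descent lemma, resp. of
the finite Csordas–Smith–Varga zero dynamics; no ζ, no H_t, no zeros-to-height input). SHARPENS
DbnHighUniform / DbnPerTFinite (it is a lemm -/
@[route_item "route-RiemannHypothesis-DBN"]
def DbnClassFloorExitTime : Prop :=
  Summit.RiemannHypothesis.RiemannHypothesis.Theorems.DbnTheory.ClassFloorExitTime

/-- `DbnClassFloorExitTime` holds: proved by `Summit.RiemannHypothesis.RiemannHypothesis.Theorems.DbnTheory.ClassFloorExitTime_holds`. -/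
theorem DbnClassFloorExitTime_holds : DbnClassFloorExitTime := _root_.Summit.RiemannHypothesis.RiemannHypothesis.Theorems.DbnTheory.ClassFloorExitTime_holds

/-- item stmt-RiemannHypothesis-18764 · support · rank 9 · closed · proved by Summit.RiemannHypothesis.RiemannHypothesis.Theorems.dbnSumSqHeightsLyapunov_closed @ 1d3b5665d0f6 (prover) · by operator
[support] T7 — for any finite configuration of distinct points z : Fin n → ℂ with velocities
`velocity z k = 2 Σ_{j≠k} 1/(z_k − z_j)`: Σ_k Im z_k · Im ż_k = − Σ_k Σ_{j≠k} (Im z_k − Im z_j)² /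
|z_k − z_j|² — the exact dissipation identity for Σ y² (finite-system form of the
Csordas–Smith–Varga / Rodgers–Tao heat-flow monotonicity; THEORY-R3 §6, Sketch3). PROVED IN TREE:
`Theorems/DBNZeroDynamics.lean`, `DbnTheory.SumSqHeightsLyapunov_holds` (p404006 ACCEPTED,
c6cdf719204d) — closer one line / `workitem close --as proved --by
Summit.RiemannHypothesis.RiemannHypothesis.Theorems.DbnTheory.SumSqHeightsLyapunov_holds`
(scratch-checked by this seat: `example : DbnSumSqHeightsLyapunov :=
DbnTheory.SumSqHeightsLyapunov_holds` elaborates, farm rc 0). RH-FREE (pure real/complex analysis of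
the two kernels of the 2001 dynamic Λ-certificate's descent lemma, resp. of the finite
Csordas–Smith–Varga zero dynamics; no ζ, no H_t, no zeros-to-height input). SHARPENS DbnHighUniform
/ DbnPerTFinite (it is a lemma of the dynamic method by which column DBN of the RH ladder records
Λ-bounds from verified height — D-0040, RECORD-KEEPING at T₀ = 3 000 175 332 800), LOWERS NOTHING:
it neither implies RH nor -/
@[route_item "route-RiemannHypothesis-DBN"]
def DbnSumSqHeightsLyapunov : Prop :=
  Summit.RiemannHypothesis.RiemannHypothesis.Theorems.DbnTheory.SumSqHeightsLyapunov

-- `DbnSumSqHeightsLyapunov` holds: proved by `Summit.RiemannHypothesis.RiemannHypothesis.Theorems.dbnSumSqHeightsLyapunov_closed` @ 1d3b5665d0f6 (its module imports this route file, so no `_holds` link can be stated here).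

/-- item stmt-RiemannHypothesis-18765 · support · rank 9 · closed · proved by Summit.RiemannHypothesis.RiemannHypothesis.Theorems.dbnUpperHeightSumDescent_closed @ 1d3b5665d0f6 (prover) · by operator
[support] T8 — for a finite conjugation-closed configuration of distinct points (∀ k ∃ j, z_j = conj
z_k), the total velocity of the upper half-plane points satisfies Σ_{Im z_k>0} Im ż_k ≤ − Σ_{Im
z_k>0} 1/Im z_k: each off-line zero is pulled down at least by its own mirror image, pair
interactions among upper points cancelling in the sum (THEORY-R3 §6, recipe THEORY-R4 §1.9). PROVED
IN TREE: `Theorems/DBNZeroDynamics.lean`, `DbnTheory.UpperHeightSumDescent_holds` (p404006) — closer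
one line / `workitem close --as proved --by …UpperHeightSumDescent_holds` (scratch-checked rc 0).
RH-FREE (pure real/complex analysis of the two kernels of the 2001 dynamic Λ-certificate's descent
lemma, resp. of the finite Csordas–Smith–Varga zero dynamics; no ζ, no H_t, no zeros-to-height
input). SHARPENS DbnHighUniform / DbnPerTFinite (it is a lemma of the dynamic method by which column
DBN of the RH ladder records Λ-bounds from verified height — D-0040, RECORD-KEEPING at T₀ = 3 000
175 332 800), LOWERS NOTHING: it neither implies RH nor enters `closes`/`Assembly` (Λ ≤ 0 ⇔ RH stays
the declared door; Rodgers–Tao Λ ≥ 0, rodgers_tao). Bears ladder rung N-P (HUMAN RULING D-0059,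
director-rh 2026-08-25T1 -/
@[route_item "route-RiemannHypothesis-DBN"]
def DbnUpperHeightSumDescent : Prop :=
  Summit.RiemannHypothesis.RiemannHypothesis.Theorems.DbnTheory.UpperHeightSumDescent

-- `DbnUpperHeightSumDescent` holds: proved by `Summit.RiemannHypothesis.RiemannHypothesis.Theorems.dbnUpperHeightSumDescent_closed` @ 1d3b5665d0f6 (its module imports this route file, so no `_holds` link can be stated here).

/-- item stmt-RiemannHypothesis-18766 · support · rank 9 · closed · proved by Summit.RiemannHypothesis.RiemannHypothesis.Theorems.dbnRoofDeficitProfile_closed @ 1d3b5665d0f6 (prover) · by operator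
[support] T9 — for Y, D > 0: ∫_{−D}^{D} 4Y/(u²+(2Y)²) du = 4 arctan(D/2Y) and ∫_{−D}^{D}
2·(2Y/(u²+Y²)) du = 8 arctan(D/Y) — the windowed version of N1's masses, quantifying how slowly the
double-row deficit 4π − 2π becomes visible in a window of half-width D (the ‘roof’ profile of
THEORY-R3 §3). PROVED IN TREE: `Theorems/DBNZeroDynamics.lean`, `DbnTheory.RoofDeficitProfile_holds`
(p404006) — closer one line / `workitem close --as proved --by …RoofDeficitProfile_holds`
(scratch-checked rc 0). RH-FREE (pure real/complex analysis of the two kernels of the 2001 dynamic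
Λ-certificate's descent lemma, resp. of the finite Csordas–Smith–Varga zero dynamics; no ζ, no H_t,
no zeros-to-height input). SHARPENS DbnHighUniform / DbnPerTFinite (it is a lemma of the dynamic
method by which column DBN of the RH ladder records Λ-bounds from verified height — D-0040,
RECORD-KEEPING at T₀ = 3 000 175 332 800), LOWERS NOTHING: it neither implies RH nor enters
`closes`/`Assembly` (Λ ≤ 0 ⇔ RH stays the declared door; Rodgers–Tao Λ ≥ 0, rodgers_tao). Bears
ladder rung N-P (HUMAN RULING D-0059, director-rh 2026-08-25T18:39:06Z). Statement = the accepted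
Prop of `Theorems/DBNDefs.lean` / `Theorems/DBNZeroD -/
@[route_item "route-RiemannHypothesis-DBN"]
def DbnRoofDeficitProfile : Prop :=
  Summit.RiemannHypothesis.RiemannHypothesis.Theorems.DbnTheory.RoofDeficitProfile

-- `DbnRoofDeficitProfile` holds: proved by `Summit.RiemannHypothesis.RiemannHypothesis.Theorems.dbnRoofDeficitProfile_closed` @ 1d3b5665d0f6 (its module imports this route file, so no `_holds` link can be stated here).

/-- item stmt-RiemannHypothesis-21574 · support · rank 9 · closed · proved by Summit.RiemannHypothesis.RiemannHypothesis.Theorems.Splittings.LinearRayLehmerWindow.linearRayRange21 (prover) · by planner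
[support] LINE L3: the certified range — for every 0 < |a| ≤ 21 the linear-ray member G_a has a
non-real zero. CLOSES BY NAME once lane (xviii-D) file #12 lands: `fun a ha h =>
Splittings.LinearRayLehmerWindow.not_hasOnlyRealZeros_linearFactorH_of_abs_le_twentyOne ha h` (eng-5
g4 Mono2 d584cf946ebc7fc4, farm rc 0; pieces in tree: (0,7/10] LinearRayOnePointWindowB, (0,π/8)
LinearRayOnePointGap, LehmerWindow Defs/Q/DipTools/LowDefs/Dip/LowQ #406–#409;
CertDip/CertLow/CertHigh/CertSub/Window/Sub pending). Why it might fail: only a filing risk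
(native_decide certificates ldDip/ldLow/ldHigh/ldSub). Sources:
HOME/rh-splitx-eng-5/lehmer/S-DBN-1-LEHMER-WINDOW-NOTE.md; cut/CUT.md. Nothing here bears on the
truth of RH. -/
@[route_item "route-RiemannHypothesis-DBN"]
def LinearRayRange21 : Prop :=
  ∀ a : ℝ, a ≠ 0 → |a| ≤ 21 → ¬ Literature.NumberTheory.LFunctions.HasOnlyRealZeros (Literature.Barriers.RiemannHypothesis.linearFactorH a)

/-- `LinearRayRange21` holds: proved by `Summit.RiemannHypothesis.RiemannHypothesis.Theorems.Splittings.LinearRayLehmerWindow.linearRayRange21`. -/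
theorem LinearRayRange21_holds : LinearRayRange21 := _root_.Summit.RiemannHypothesis.RiemannHypothesis.Theorems.Splittings.LinearRayLehmerWindow.linearRayRange21

/-- item stmt-RiemannHypothesis-21604 · support · rank 9 · open · by planner
[support · schedule rung 1 · INSTRUMENT-DECIDABLE NOW] dips covering 21 < a ≤ 60: predicted
witnesses (design estimates, uncertified) — Lehmer pair t = 7005.063/7005.101 (x-gap 0.0754) covers
a ∈ [~12, ~23.7]; Lehman's pair t = 71732.9012/71732.9159 (x-gap 0.0294, Lehman 1966 p.10) covers a
∈ [~25, ~61] with ℓ ≈ 0.3–0.5; if a sliver near a ≈ 24 is uncovered, the pair t =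
17143.786/17143.822 (x-gap 0.0706, reach ≈ 25.5) fills it. Instrument: eng-5's kernel
Φ-quadrature/Taylor-model evaluator of H_0, H_0', H_0'', H_0''' at x ≈ 1.4347·10⁵ (10× the Lehmer
height; scale-free form: all six numbers relative to a common κ) + `norm_num` on the margin of
LinearRayDipCertificate. With LinearRayDipCertificate this rung yields «no hyperbolic member for 0 <
|a| ≤ 60» (glue `schedule60_of`, kernel-checked). Why it might fail: the curvature-drift term
M₃·2/a₁ or the tail 2a₁²e^{−a₁ℓ}(P+B) at 71732.9 may push a₁ above 23.7 (then one more pair with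
x-gap ∈ [0.04, 0.06] below t = 10⁶ is needed — ~10² exist by GUE counts). Sources:
doi:10.1090/s0025-5718-1966-0203909-5 p.10;
HOME/rh-splitx-eng-5/lehmer/S-DBN-1-LEHMER-WINDOW-NOTE.md. Nothing here bears on the truth of RH. -/
@[route_item "route-RiemannHypothesis-DBN"]
def LinearRayDipScheduleTo60 : Prop :=
  ∀ a : ℝ, 21 < a → a ≤ 60 → ∃ (σ x x' ℓ a₁ a₂ d F₁ F₂ M₃ P B : ℝ), (σ = 1 ∨ σ = -1) ∧ 0 ≤ x ∧ x < x' ∧ 0 < ℓ ∧ 0 < a₁ ∧ 2 ≤ a₁ * ℓ ∧ a₁ ≤ a₂ ∧ 0 ≤ B ∧ 0 < σ * (Literature.NumberTheory.LFunctions.deBruijnH 0 ((x : ℝ) : ℂ)).re ∧ σ * (Literature.NumberTheory.LFunctions.deBruijnH 0 ((x' : ℝ) : ℂ)).re < 0 ∧ -d ≤ σ * (Literature.NumberTheory.LFunctions.deBruijnH 0 ((x' : ℝ) : ℂ)).re ∧ |(Literature.NumberTheory.LFunctions.deBruijnH0Deriv 1 ((x' : ℝ) : ℂ)).re| ≤ F₁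 ∧ F₂ ≤ σ * (Literature.NumberTheory.LFunctions.deBruijnH0Deriv 2 ((x' : ℝ) : ℂ)).re ∧ (∀ t ∈ Set.Icc x (x' + ℓ), |(Literature.NumberTheory.LFunctions.deBruijnH0Deriv 3 ((t : ℝ) : ℂ)).re| ≤ M₃) ∧ (∀ t ∈ Set.Icc (x + ℓ) (x' + ℓ), |(Literature.NumberTheory.LFunctions.deBruijnH0Deriv 0 ((t : ℝ) : ℂ)).re| + |(Literature.NumberTheory.LFunctions.deBruijnH0Deriv 1 ((t : ℝ) : ℂ)).re| / a₁ + |(Literature.NumberTheory.LFunctions.deBruijnH0Deriv 2 ((t : ℝ) : ℂ)).re| / a₁ ^ 2 ≤ P) ∧ (∀ t : ℝ, x + ℓ ≤ t → -B ≤ σ * (Literature.NumberTheory.LFunctions.deBruijnH 0 ((t : ℝ) : ℂ)).re) ∧ 2 * a₂ ^ 2 * d + 2 * F₁ * (a₂ + a₂ ^ 2 * (x' - x)) + M₃ * (a₂ ^ 2 * (x' - x) ^ 3 / 3 + a₂ * (x' - x) ^ 2 + 2 * (x' - x) + 2 / a₁) + 2 * a₁ ^ 2 * Real.exp (-(a₁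 * ℓ)) * (P + B) < F₂ ∧ a₁ ≤ a ∧ a ≤ a₂

/-- item stmt-RiemannHypothesis-21605 · support · rank 9 · open · by planner
[support · schedule rung 2 · needs NEW INSTRUMENT «T-RS» (certified Riemann–Siegel evaluator of Z,
Z', Z'', Z''' at t ~ 10¹³: Arias de Reyna 2011 rigorous RS remainder bounds as a cited named fact,
~1.1·10⁶-term main sum in kernel or via certified ball arithmetic transcript)] dips covering 60 < a
≤ 10⁵: predicted witness = the Gourdon–Demichel champion pair t_K = 7954022502373.43289015387,
t_{K+1} = …43289494012 (gap 4.7863·10⁻⁶, neighbours at −0.311 and +0.301; Saouter–Gourdon–Demichel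
2011 Tables 1–2), x-gap 9.57·10⁻⁶ ⇒ a₂ ≈ 1.9·10⁵, and a₁ ≈ 24 with ℓ = 0.4 (tail 2a₁²e^{−9.6}(P+B) ≈
0.05F₂, drift M₃·2/a₁ ≈ 0.11F₂ by the envelope slope π/8) — ONE certificate for four decades of a.
RH at that height is NOT needed (real-axis data only). Why it might fail: instrument
cost/availability (kernel RS at 10¹³), or an unexpectedly large local curvature drift at the
champion; fallback witnesses: the other ten pairs of SGD Table 1 (gaps ≤ 1.04·10⁻⁵ ⇒ a₂ ≥ 8·10⁴).
Sources: doi:10.1090/s0025-5718-2011-02472-5; Arias de Reyna, Math. Comp. 80 (2011) 995–1009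
(doi:10.1090/S0025-5718-2010-02426-3). Nothing here bears on the truth of RH. -/
@[route_item "route-RiemannHypothesis-DBN"]
def LinearRayDipScheduleTo1e5 : Prop :=
  ∀ a : ℝ, 60 < a → a ≤ 100000 → ∃ (σ x x' ℓ a₁ a₂ d F₁ F₂ M₃ P B : ℝ), (σ = 1 ∨ σ = -1) ∧ 0 ≤ x ∧ x < x' ∧ 0 < ℓ ∧ 0 < a₁ ∧ 2 ≤ a₁ * ℓ ∧ a₁ ≤ a₂ ∧ 0 ≤ B ∧ 0 < σ * (Literature.NumberTheory.LFunctions.deBruijnH 0 ((x : ℝ) : ℂ)).re ∧ σ * (Literature.NumberTheory.LFunctions.deBruijnH 0 ((x' : ℝ) : ℂ)).re < 0 ∧ -d ≤ σ * (Literature.NumberTheory.LFunctions.deBruijnH 0 ((x' : ℝ) : ℂ)).re ∧ |(Literature.NumberTheory.LFunctions.deBruijnH0Deriv 1 ((x' : ℝ) : ℂ)).re| ≤ F₁ ∧ F₂ ≤ σ * (Literature.NumberTheory.LFunctions.deBruijnH0Deriv 2 ((x' : ℝ) : ℂ)).re ∧ (∀ t ∈ Set.Icc x (x' + ℓ), |(Literature.NumberTheory.LFunctions.deBruijnH0Deriv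 3 ((t : ℝ) : ℂ)).re| ≤ M₃) ∧ (∀ t ∈ Set.Icc (x + ℓ) (x' + ℓ), |(Literature.NumberTheory.LFunctions.deBruijnH0Deriv 0 ((t : ℝ) : ℂ)).re| + |(Literature.NumberTheory.LFunctions.deBruijnH0Deriv 1 ((t : ℝ) : ℂ)).re| / a₁ + |(Literature.NumberTheory.LFunctions.deBruijnH0Deriv 2 ((t : ℝ) : ℂ)).re| / a₁ ^ 2 ≤ P) ∧ (∀ t : ℝ, x + ℓ ≤ t → -B ≤ σ * (Literature.NumberTheory.LFunctions.deBruijnH 0 ((t : ℝ) : ℂ)).re) ∧ 2 * a₂ ^ 2 * d + 2 * F₁ * (a₂ + a₂ ^ 2 * (x' - x)) + M₃ * (a₂ ^ 2 * (x' - x) ^ 3 / 3 + a₂ * (x' - x) ^ 2 + 2 * (x' - x) + 2 / a₁) + 2 * a₁ ^ 2 * Real.exp (-(a₁ * ℓ)) * (P + B) < F₂ ∧ a₁ ≤ a ∧ a ≤ a₂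

/-- item stmt-RiemannHypothesis-22359 · support · rank 9 · closed · proved by Summit.RiemannHypothesis.RiemannHypothesis.Theorems.Splittings.LinearRayZeroSigns.linearRayMirrorSqueeze_proof (prover) · by planner
[support, PROVABLE NOW, ~150-300 lines; LINE 3 «TWO-RAY LAGUERRE SQUEEZE» (ideator rh-idea-2,
D-0145, dictionary import: the two-sided factor F_a = deBruijnHDiv(1+u²/a²) is the AVERAGE of the
two rays, linearFactorH a = F_a + F_a'/a and linearFactorH(−a) = F_a − F_a'/a (tree:
linearFactorH_eq_deBruijnHDiv_add_deriv, kernel even in a), and Ray(a) ⇔ Ray(−a)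
(hasOnlyRealZeros_linearFactorH_neg_iff)). STATEMENT: under Ray(a), at every SIMPLE real zero x of
H_0 the two rays take (weakly) opposite signs: Re G_a(x) · Re G_{−a}(x) ≤ 0 (equivalently |F_a(x)| ≤
|F_a'(x)|/a; equivalently G_a(x)·G_a(−x) ≤ 0 by linearFactorH_neg and evenness). PROOF: Laguerre for
rayG(a) = F' + aF = a·G_a (Splittings.LinearRayTwoPoint.laguerre_rayG, any a ≠ 0, GIVEN the ray) at
x, with the ODE deriv_rayG (G_a' = aG_a − aH_0, so at a zero of H_0: G_a' = aG_a, G_a'' = a²G_a −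
aH_0') gives G_a(x)·H_0'(x) ≥ 0; the same for −a (ray obtained from neg_iff) gives G_{−a}(x)·H_0'(x)
≤ 0; multiply (H_0'(x) ≠ 0). It is the conjunction of the two one-point Laguerre certificates at a
zero (B20 family, finite reach ≈ |H_0''/H_0'|(x) ≈ 2/gap per zero) — its use is LINE 3's swing
lemma. Nothing here bears on the truth of RH.] -/
@[route_item "route-RiemannHypothesis-DBN"]
def LinearRayMirrorSqueeze : Prop :=
  ∀ a : ℝ, 0 < a → Literature.NumberTheory.LFunctions.HasOnlyRealZeros (Literature.Barriers.RiemannHypothesis.linearFactorH a) → ∀ x : ℝ, Literature.NumberTheory.LFunctions.deBruijnH 0 ((x : ℝ) : ℂ) = 0 → Literature.NumberTheory.LFunctions.deBruijnH0Deriv 1 ((x : ℝ) : ℂ) ≠ 0 → (Literature.Barriers.RiemannHypothesis.linearFactorH a ((x : ℝ) : ℂ)).re * (Literature.Barriers.RiemannHypothesis.linearFactorH (-a) ((x : ℝ) : ℂ)).re ≤ 0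

-- `LinearRayMirrorSqueeze` holds: proved by `Summit.RiemannHypothesis.RiemannHypothesis.Theorems.Splittings.LinearRayZeroSigns.linearRayMirrorSqueeze_proof` (its module imports this route file, so no `_holds` link can be stated here).

/-- item stmt-RiemannHypothesis-22511 · support · rank 9 · open · by planner
why it might fail: only a numerical surprise in H_0'''' or the Laplace tails at t≈7.2e4 (design margin ×19, uncertified kit j289589)
sources: doi:10.1090/S0025-5718-1966-0203909-5, tree:Literature.NumberTheory.LFunctions.deBruijnHDiv_laplace_sub_deriv_deriv
[support/rung, finite witness of 22394's shape, RH-free, INSTRUMENT target] At the Lehman bump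
(zeros of H_0 at x = 2t, t ≈ 71732.9012 / 71732.9159, x-gap δ ≈ 0.0294) with a = 25: consecutive
simple real zeros x₁ < x₂ of H_0 with 25·δ ≤ 1 and 25·δ·|H_0(y)| < |F_25(y)| on [x₁,x₂], F_25 =
deBruijnHDiv(1+u²/625). Design check (uncertified, kit j289589 data): F_25 ≈ H_0 − F₂/625 on the
gap, |F_25| ≈ 1.5e-3·F₂ vs 25·δ·|H_0| ≤ 7.9e-5·F₂ (factor ≈ 19). With LinearRaySwingLemma (22393) it
gives ¬Ray(25) (glue not_ray25_of_witness, kernel-checked in LINE3-TwoRaySqueeze-glue.lean) — a BC5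
witness that the squeeze supply statement is decidable at finite height; instrument: eng-5-class
certified evaluator at t ≈ 7.2e4 with F_a = H_0 + H_0''/a² + H_0''''/a⁴ ± M_6/a⁶ ± e^{-aℓ} tails.
Why it might fail: only by a numerical surprise in H_0'''' or the tails (margin ×19). Sources:
Lehman 1966 Math. Comp. 20 (corpus doi-10-1090-s0025-5718-1966-0203909-5 p10); tree
deBruijnHDiv_laplace_sub_deriv_deriv. -/
@[route_item "route-RiemannHypothesis-DBN"]
def TypicalGapSqueezeWitness25 : Prop :=
  ∃ x₁ x₂ : ℝ, 140000 < x₁ ∧ x₁ < x₂ ∧ 25 * (x₂ - x₁) ≤ 1 ∧ Literature.NumberTheory.LFunctions.deBruijnH 0 ((x₁ : ℝ) : ℂ) = 0 ∧ Literature.NumberTheory.LFunctions.deBruijnH 0 ((x₂ : ℝ) : ℂ) = 0 ∧ Literature.NumberTheory.LFunctions.deBruijnH0Deriv 1 ((x₁ : ℝ) : ℂ) ≠ 0 ∧ Literature.NumberTheory.LFunctions.deBruijnH0Deriv 1 ((x₂ : ℝ) : ℂ) ≠ 0 ∧ (∀ z ∈ Set.Ioo x₁ x₂, Literature.NumberTheory.LFunctions.deBruijnH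 0 ((z : ℝ) : ℂ) ≠ 0) ∧ ∀ y ∈ Set.Icc x₁ x₂, 25 * (x₂ - x₁) * |(Literature.NumberTheory.LFunctions.deBruijnH 0 ((y : ℝ) : ℂ)).re| < |(Literature.NumberTheory.LFunctions.deBruijnHDiv (fun u : ℝ => 1 + u ^ 2 / (25 : ℝ) ^ 2) ((y : ℝ) : ℂ)).re|

/-- item stmt-RiemannHypothesis-0276 · assembly · rank 1 · closed · proved by Summit.RiemannHypothesis.RiemannHypothesis.Theorems.dbnAssembly_proof' (prover) · by planner
X gives Λ ≤ 0 via the fact Literature.NumberTheory.LFunctions.deBruijnNewmanConst_le_iff at t = 0;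
Newman closedness (fact
Literature.NumberTheory.LFunctions.hasOnlyRealZeros_deBruijnH_iff_deBruijnNewmanConst_le, Hurwitz)
gives HasOnlyRealZeros (deBruijnH 0); then RH by the fact
Literature.NumberTheory.LFunctions.riemannHypothesis_iff_hasOnlyRealZeros_deBruijnH_zero. Expected
discharge with those three named facts as hypotheses. -/
@[route_item "route-RiemannHypothesis-DBN", crux]
def Assembly : Prop :=
  (∀ t : ℝ, 0 < t → Literature.NumberTheory.LFunctions.HasOnlyRealZeros (Literature.NumberTheory.LFunctions.deBruijnH t)) → Summit.RiemannHypothesis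

-- `Assembly` holds: proved by `Summit.RiemannHypothesis.RiemannHypothesis.Theorems.dbnAssembly_proof'` (its module imports this route file, so no `_holds` link can be stated here).

/-! D-0027 §2.1 — DECIDING THEOREM (planner-authored via `route open/edit --closes-file`; by planner-rrepair-RiemannHypothesis-DBN-5625a712-0 2026-08-15T16:36:19Z):
its hypotheses are this route's items and its conclusion the sub-problem Statement (glue_lint), and it elaborates with this file. -/

/-- **Deciding theorem of route `RiemannHypothesis/DBN`** (D-0027 §2.1).
The two cruxes — HIGH zeros real uniformly in `t > 0` (`DbnHighUniform`, `|Re z| ≥ 6·10¹²`) and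
LOW zeros real (`DbnLowAllT`, `|Re z| < 6·10¹²`) — give thesis X (`H_t` has only real zeros for
every `t > 0`) by a case split on `|Re z|`; the item `Assembly` (X → `Summit.RiemannHypothesis`,
de Bruijn 1950 Thm. 13 + Newman 1976 Thm. 3 closedness at `t = 0` + `H_0 = ξ(½+iz/2)/8`; in the
tree it is the PROVED theorem
`Literature.NumberTheory.LFunctions.riemannHypothesis_of_hasOnlyRealZeros_deBruijnH_holds` of
`DeBruijnNewmanConstProofs.lean`, which a prover cites in one line from a Theorems file) finishes.
Pure logic; the route file itself imports only `DeBruijnNewman.lean`. -/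
@[closes "route-RiemannHypothesis-DBN"] theorem closes (hHigh : DbnHighUniform) (hLow : DbnLowAllT) (hAsm : Assembly) :
    _root_.Summit.RiemannHypothesis := by
  refine hAsm ?_
  intro t ht z hz
  rcases le_or_gt 6000000000000 |z.re| with hle | hlt
  · exact hHigh t ht z hz hle
  · exact hLow t ht z hz hlt

end Summit.RiemannHypothesis.RiemannHypothesis.Theses.DBN
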